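import Summits.QuantumFields.BalabanUV.T4Continuum.Support.NE7SlicePoincareTA
import Summits.QuantumFields.BalabanUV.T4Continuum.Support.NE3ClassRadiusFamily

/-!
# NE7SlicePoincareTAClass — (H1) ON PRINT's SLICE `T_A` IS A THEOREM ON THE SMALL-FIELD CLASS: for `3 ≤ d`, `2 ≤ L`, `1 ≤ N`, class radius `0 < ε ≤ θ`, K1 cut `εc > 0`, row NE3's two ε-lines
# and four k-free numeric lines, and ONE more k-free line (the orbit comparison's), every `W ∈ sfClass d L N ε (j+1)` satisfies the slice Poincaré inequality on
# `T_A = ker Q̄_W ∩ {R D_W† = 0}` with the k-UNIFORM constant `4·n·(1 + 4·n·d·(2 + 2(d−1)ε)²·(2·64^d)²)·CPLine·M²` — F223's orbit comparison composed with row NE3's class theorem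
# `NE3ClassRadiusFamily.classSlicePoincare_of_lines'` (file 154 of the curved (APE), F225)

Cell `pub-balaban`, rung (B)+1 sub-cell t4, lineage `b2b-balaban-t4-ne7-p1` (CRUX PROVER NE7 #1 = OWNER of row NE7), generation 86; memo
`t4/b2b-balaban-t4-ne7-p1-g86/ORBIT-COMPARISON.md` §4.  Over F223 `NE7SlicePoincareTA.slicePoincare_TA_of_frameFree`, row NE3-R2's `NE3ClassRadiusFamily.classSlicePoincare_of_lines'` ∕ `CPLine_nonneg` ∕
`levelSmall_family`, `NE3ClassSlicePoincare.xi_of_line` (the gauge Poincaré regime from line 4), `NE3SlicePoincareShape.slicePoincare_mono` and `NE7SquaredBumpNestedMeanOperator.inv_le_tentMean2` BY NAME.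
WHAT ([folklore]; 0 def, 0 sorry).  §1 the k-free top of the orbit comparison's constant: `cdivSq_le` (`C_div²(M, x = ε∕M²) ≤ n·d·(2 + 2(d−1)ε)²·(2·64^d)²`) and `regTA_of_line` (the class line of
F223 from the k-free line `32·n²·#Plane·ε²·(2 + 2(1 + 4·n·d·(2+2(d−1)ε)²·(2·64^d)²))·CPLine ≤ 1∕2`); §2 **`slicePoincare_TA_sfClass`**: (H1) for every level `j` and every `W` of the class, at
`x = ε∕(L^{j+1})²`, in the literal shape of F217∕F218's (H1).
HONEST FRAMING (page 1): (H1) — hence (CP_W) and (P_a) ([B9] Thm 3.11 SHAPE for OUR `softSymOpKa`) in F212's regime — are now THEOREMS on the class (rung (B)+1, finite T⁴); the rows (C) of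
`cGreenSymKa` ([B9] Thm 3.3∕(3.49) SHAPE) remain DISPLAYED in the END; (KL-B), (APE) on curved data NOT proved unconditionally; NOT ONE-STEP, NOT NE7; spine 0∕9; finite T⁴ rung (B)+1 —
NOT infinite volume, NOT mass gap, NOT `BetaPertH`, NOT Clay.  Continuum YM on T⁴ ⇐ BetaPertH ∧ nine spine estimates (0/9 proved); BetaPertH ⇐ (D1) ∧ (D4) ∧ CAP+tail; G-an2-4 gates asym,
D1 and NE2/3/4.
-/

set_option autoImplicit false

open scoped BigOperators InnerProductSpace Matrix Matrix.Norms.L2Operator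
open Finset

namespace Summit.QuantumFields.BalabanUV.T4Continuum.NE7SlicePoincareTAClass

open Literature.MathematicalPhysics.QuantumFieldTheory.Balaban1983to89
open B7Prop1Explicit B7Prop2Explicit UnitaryModel MatrixNorms
open T4AveragingDeficitWall (IsUnitaryCfg IsSkewDir SmallField dirSq curlSq)
open T4AveragingDeficitWallBoundary (periodBox IsPeriodicCfg)
open AveragingDeficitMultiLevelPrep (LevelSmall)
open AveragingDeficitTwoLevelPrep (twoLevelSmall prop1Radius)
open SpreadLift (loopRad)
open NE3HilbertSchmidtTorus
open NE3FrameFreeSliceW (frameFreeBlockLandauW)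
open NE3SlicePoincareShape (SlicePoincare slicePoincare_mono)
open NE3CovariantLineSumsError (sq_mul_le_prop1Radius)
open NE3CovariantLineSumsL2 (C2sq)
open NE3CovariantLineSumsL2Tower (rho)
open NE3SlicePoincareBudgetLine (ShLine SmallYLine CPLine)
open NE3ClassSlicePoincare (xi_of_line)
open NE3ClassRadiusFamily (classSlicePoincare_of_lines' CPLine_nonneg levelSmall_family)
open MinimalActionRate (sfClass)
open NE7BalabanSoftOperator
open NE7SquaredBumpNestedMeanOperator (tentMean2 tentMean2_pos inv_le_tentMean2)
open NE7SlicePoincareTA (slicePoincare_TA_of_frameFree)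

noncomputable section

variable {d : ℕ} {n : Type*} [Fintype n] [DecidableEq n]

/-! ## §1 The k-free tops -/

omit [Fintype n] [DecidableEq n] in
/-- **`C_div²` AT `x = ε∕M²` IS k-FREE BOUNDED**: `n·d·(2 + 2(d−1)(M−1)·M·x)²·(2∕tentMean2)² ≤ n·d·(2 + 2(d−1)ε)²·(2·64^d)²` (`M ≥ 2`, `d ≥ 1`, `0 ≤ ε`, `M²x = ε`). [folklore] -/
theorem cdivSq_le (hd : 1 ≤ d) {L : ℕ} (hL : 2 ≤ L) (j : ℕ) (c : ℕ) {ε : ℝ} (hε : 0 ≤ ε) :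
    (c : ℝ) * d * (2 + 2 * (((d : ℝ) - 1) * (((L : ℝ) ^ (j + 1)) - 1) * (ε / ((L : ℝ) ^ (j + 1)) ^ 2)) * (L : ℝ) ^ (j + 1)) ^ 2 * (2 / tentMean2 d (L ^ (j + 1))) ^ 2
      ≤ (c : ℝ) * d * (2 + 2 * (((d : ℝ) - 1) * ε)) ^ 2 * (2 * (64 : ℝ) ^ d) ^ 2 := by
  have hM2 : 2 ≤ L ^ (j + 1) := le_trans hL (Nat.le_self_pow (Nat.succ_ne_zero j) L)
  have hL1 : (1 : ℝ) ≤ L := by exact_mod_cast (show 1 ≤ L by omega)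
  have hM1 : (1 : ℝ) ≤ (L : ℝ) ^ (j + 1) := one_le_pow₀ hL1
  have hM0 : (0 : ℝ) < (L : ℝ) ^ (j + 1) := by positivity
  have hd1 : (1 : ℝ) ≤ d := by exact_mod_cast hd
  have hdm : 0 ≤ (d : ℝ) - 1 := by linarith
  have ht := tentMean2_pos hM2 d
  have hinv := inv_le_tentMean2 hM2 d
  -- `(M−1)·(ε∕M²)·M ≤ ε`
  have h1 : (((L : ℝ) ^ (j + 1)) - 1) * (ε / ((L : ℝ) ^ (j + 1)) ^ 2) * (L : ℝ) ^ (j + 1) ≤ ε := by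
    rw [show (((L : ℝ) ^ (j + 1)) - 1) * (ε / ((L : ℝ) ^ (j + 1)) ^ 2) * (L : ℝ) ^ (j + 1) = ε * ((((L : ℝ) ^ (j + 1)) - 1) / (L : ℝ) ^ (j + 1)) by
      field_simp]
    have : (((L : ℝ) ^ (j + 1)) - 1) / (L : ℝ) ^ (j + 1) ≤ 1 := by rw [div_le_one hM0]; linarith
    calc ε * ((((L : ℝ) ^ (j + 1)) - 1) / (L : ℝ) ^ (j + 1)) ≤ ε * 1 := mul_le_mul_of_nonneg_left this hε
      _ = ε := mul_one ε
  have h1' : 0 ≤ (((L : ℝ) ^ (j + 1)) - 1) * (ε / ((L : ℝ) ^ (j + 1)) ^ 2) * (L : ℝ) ^ (j + 1) :=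
    mul_nonneg (mul_nonneg (by linarith) (by positivity)) hM0.le
  have key : ((d : ℝ) - 1) * (((L : ℝ) ^ (j + 1)) - 1) * (ε / ((L : ℝ) ^ (j + 1)) ^ 2) * (L : ℝ) ^ (j + 1) ≤ ((d : ℝ) - 1) * ε := by
    have e : ((d : ℝ) - 1) * (((L : ℝ) ^ (j + 1)) - 1) * (ε / ((L : ℝ) ^ (j + 1)) ^ 2) * (L : ℝ) ^ (j + 1)
        = ((d : ℝ) - 1) * ((((L : ℝ) ^ (j + 1)) - 1) * (ε / ((L : ℝ) ^ (j + 1)) ^ 2) * (L : ℝ) ^ (j + 1)) := by ring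
    rw [e]; exact mul_le_mul_of_nonneg_left h1 hdm
  have key0 : 0 ≤ ((d : ℝ) - 1) * (((L : ℝ) ^ (j + 1)) - 1) * (ε / ((L : ℝ) ^ (j + 1)) ^ 2) * (L : ℝ) ^ (j + 1) := by
    have e : ((d : ℝ) - 1) * (((L : ℝ) ^ (j + 1)) - 1) * (ε / ((L : ℝ) ^ (j + 1)) ^ 2) * (L : ℝ) ^ (j + 1)
        = ((d : ℝ) - 1) * ((((L : ℝ) ^ (j + 1)) - 1) * (ε / ((L : ℝ) ^ (j + 1)) ^ 2) * (L : ℝ) ^ (j + 1)) := by ring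
    rw [e]; exact mul_nonneg hdm h1'
  have h2 : 2 + 2 * (((d : ℝ) - 1) * (((L : ℝ) ^ (j + 1)) - 1) * (ε / ((L : ℝ) ^ (j + 1)) ^ 2)) * (L : ℝ) ^ (j + 1) ≤ 2 + 2 * (((d : ℝ) - 1) * ε) := by
    have e : 2 + 2 * (((d : ℝ) - 1) * (((L : ℝ) ^ (j + 1)) - 1) * (ε / ((L : ℝ) ^ (j + 1)) ^ 2)) * (L : ℝ) ^ (j + 1)
        = 2 + 2 * (((d : ℝ) - 1) * (((L : ℝ) ^ (j + 1)) - 1) * (ε / ((L : ℝ) ^ (j + 1)) ^ 2) * (L : ℝ) ^ (j + 1)) := by ring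
    rw [e]; linarith [key]
  have h2' : 0 ≤ 2 + 2 * (((d : ℝ) - 1) * (((L : ℝ) ^ (j + 1)) - 1) * (ε / ((L : ℝ) ^ (j + 1)) ^ 2)) * (L : ℝ) ^ (j + 1) := by
    have e : 2 + 2 * (((d : ℝ) - 1) * (((L : ℝ) ^ (j + 1)) - 1) * (ε / ((L : ℝ) ^ (j + 1)) ^ 2)) * (L : ℝ) ^ (j + 1)
        = 2 + 2 * (((d : ℝ) - 1) * (((L : ℝ) ^ (j + 1)) - 1) * (ε / ((L : ℝ) ^ (j + 1)) ^ 2) * (L : ℝ) ^ (j + 1)) := by ring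
    rw [e]; linarith [key0]
  -- `2∕tentMean2 ≤ 2·64^d`
  have h3 : 2 / tentMean2 d (L ^ (j + 1)) ≤ 2 * (64 : ℝ) ^ d := by
    rw [div_le_iff₀ ht]
    have h64 : (0 : ℝ) < (64 : ℝ) ^ d := by positivity
    have : 1 ≤ (64 : ℝ) ^ d * tentMean2 d (L ^ (j + 1)) := by
      have := mul_le_mul_of_nonneg_left hinv h64.le
      rwa [mul_inv_cancel₀ h64.ne'] at this
    nlinarith
  have h3' : 0 ≤ 2 / tentMean2 d (L ^ (j + 1)) := by positivity
  have hc0 : 0 ≤ (c : ℝ) * d := by positivity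
  calc (c : ℝ) * d * (2 + 2 * (((d : ℝ) - 1) * (((L : ℝ) ^ (j + 1)) - 1) * (ε / ((L : ℝ) ^ (j + 1)) ^ 2)) * (L : ℝ) ^ (j + 1)) ^ 2 * (2 / tentMean2 d (L ^ (j + 1))) ^ 2
      ≤ (c : ℝ) * d * (2 + 2 * (((d : ℝ) - 1) * ε)) ^ 2 * (2 * (64 : ℝ) ^ d) ^ 2 := by
        gcongr

/-! ## §2 (H1) on the class -/

/-- **(H1) ON PRINT's SLICE `T_A`, UNIFORMLY ON THE SMALL-FIELD CLASS.**  Data: `3 ≤ d`, `2 ≤ L`, `1 ≤ N`; class radius `0 < ε ≤ θ`, K1 cut `0 < εc`; row NE3-R2's two ε-lines and four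
k-free numeric lines (`NE3ClassRadiusFamily.classSlicePoincare_of_lines'`); ONE more k-free line `32·n²·#Plane·ε²·(2 + 2(1 + 4·n·d·(2+2(d−1)ε)²·(2·64^d)²))·CPLine ≤ 1∕2`.  THEN for every
level `j` and every `W ∈ sfClass d L N ε (j+1)`, at the class radius `x = ε∕(L^{j+1})²`, every skew torus 1-form `t` with `Q̄_W t = 0`, `R D_W† t = 0` obeys
`dirSq(extF t) ≤ 4·n·(1 + 4·n·d·(2+2(d−1)ε)²·(2·64^d)²)·CPLine·M²·curlSq_W(extF t)` — a k-UNIFORM constant times `M²`. [folklore] -/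
theorem slicePoincare_TA_sfClass [Nonempty n] (hd : 3 ≤ d) {L N : ℕ} [NeZero N] (hL : 2 ≤ L) {ε θ εc : ℝ}
    (hε : 0 < ε) (hεθ : ε ≤ θ) (hεc : 0 < εc)
    (hε1 : 16 * (14464 * ((d : ℝ) + 1) ^ 2 * ((d : ℝ) + 4) ^ 2) * ε ≤ 3)
    (hε2 : 2 * twoLevelSmall d L * ε ≤ (L : ℝ) ^ 2)
    (h1 : ShLine d L (Fintype.card n) εc θ ≤ 1 / 2) (h2 : SmallYLine d L (Fintype.card n) εc θ ≤ 1 / 2)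
    (h3 : 68 / 3 * (((d : ℝ) + 1) * ((d : ℝ) + 4)) * C2sq d L * θ ≤ rho d L / 2)
    (h4 : 8 * d * (((d : ℝ) - 1) * θ) ^ 2
      + 2 * ((Fintype.card n : ℝ) * ((4 * (d : ℝ) ^ 2 + 272 * d * (((d : ℝ) + 1) * ((d : ℝ) + 4))) * θ) ^ 2) ≤ 1 / 2)
    (h5 : 32 * (Fintype.card n : ℝ) ^ 2 * (Fintype.card (T4AveragingDeficitWall.Plane d)) * ε ^ 2
      * (2 + 2 * (1 + 4 * ((Fintype.card n : ℝ) * d * (2 + 2 * (((d : ℝ) - 1) * ε)) ^ 2 * (2 * (64 : ℝ) ^ d) ^ 2))) * CPLine d L (Fintype.card n) εc θ ≤ 1 / 2)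
    (j : ℕ) [NeZero (N * L ^ (j + 1))] {W : Site d → Fin d → (Matrix n n ℂ)ˣ} (hW : W ∈ sfClass d L N ε (j + 1))
    -- the class radius at level `j+1` read as the END's `x`, with its `LevelSmall` letter (both determined by the class data; displayed so that `qbarOpK` can be named)
    {x : ℝ} (hxε : x = ε / ((L : ℝ) ^ (j + 1)) ^ 2) (hx : 0 ≤ x) (hs : LevelSmall d L j x) (hWx : SmallField W x) :
    ∀ t : skewForms d n (N * L ^ (j + 1)), qbarOpK (N := N) (one_le_two.trans hL) j hW.1 hx hs hWx t = 0 →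
      landauProjK L N (j + 1) W
          ((LinearMap.adjoint (𝕜 := ℝ) (E := skewSecs d n (N * L ^ (j + 1))) (F := skewForms d n (N * L ^ (j + 1))) (gradOpK hW.1 (N * L ^ (j + 1)))
            : skewForms d n (N * L ^ (j + 1)) →ₗ[ℝ] skewSecs d n (N * L ^ (j + 1))) t) = 0 →
      dirSq (extF (N * L ^ (j + 1)) (t : Form d n (N * L ^ (j + 1)))) (periodBox (d := d) (N * L ^ (j + 1)))
        ≤ (4 * (Fintype.card n : ℝ) * (1 + 4 * ((Fintype.card n : ℝ) * d * (2 + 2 * (((d : ℝ) - 1) * ε)) ^ 2 * (2 * (64 : ℝ) ^ d) ^ 2))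
            * CPLine d L (Fintype.card n) εc θ * ((L : ℝ) ^ (j + 1)) ^ 2)
          * curlSq W (extF (N * L ^ (j + 1)) (t : Form d n (N * L ^ (j + 1)))) (periodBox (d := d) (N * L ^ (j + 1))) := by
  intro t htQ htR
  obtain ⟨hWu, hWP, hWxε⟩ := hW
  have hd1 : 1 ≤ d := by omega
  have hN : 1 ≤ N := Nat.one_le_iff_ne_zero.mpr (NeZero.ne N)
  have hLd : 2 ≤ L ^ d := le_trans hL (Nat.le_self_pow (by omega) L)
  have hL0 : (0 : ℝ) < L := by exact_mod_cast (show 0 < L by omega)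
  have hM0 : (0 : ℝ) < (L : ℝ) ^ (j + 1) := by positivity
  have hc : (1 : ℝ) ≤ (Fintype.card n : ℝ) := by exact_mod_cast Fintype.card_pos
  -- row NE3's (P♮)_W on its slice, at this level and background
  have hP := classSlicePoincare_of_lines' hd hL hN hε hεθ hεc hε1 hε2 h1 h2 h3 h4 j W ⟨hWu, hWP, hWxε⟩
  have hCP : 0 ≤ CPLine d L (Fintype.card n) εc θ := CPLine_nonneg hd1 (Nat.cast_nonneg _) hεc.le (hε.le.trans hεθ)
  -- the gauge Poincaré regime at `x` from line 4
  have hθx : ((L : ℝ) ^ (j + 1)) ^ 2 * x ≤ θ := by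
    rw [hxε, mul_div_cancel₀ _ (by positivity)]; exact hεθ
  have hsmallG := xi_of_line (c := Fintype.card n) hd1 hL j hx hs hθx h4
  -- the orbit comparison's class line from line 5
  set A₅ : ℝ := 1 + 4 * ((Fintype.card n : ℝ) * d * (2 + 2 * (((d : ℝ) - 1) * ε)) ^ 2 * (2 * (64 : ℝ) ^ d) ^ 2) with hA₅
  set A : ℝ := 1 + 4 * ((Fintype.card n : ℝ) * d * (2 + 2 * (((d : ℝ) - 1) * (((L : ℝ) ^ (j + 1)) - 1) * x) * (L : ℝ) ^ (j + 1)) ^ 2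
      * (2 / tentMean2 d (L ^ (j + 1))) ^ 2) with hA
  have hAA : A ≤ A₅ := by
    have h := cdivSq_le hd1 hL j (Fintype.card n) hε.le
    rw [← hxε] at h
    rw [hA, hA₅]; linarith
  have hA0 : 0 ≤ A := by rw [hA]; positivity
  have hx2 : x ^ 2 * ((L : ℝ) ^ (j + 1)) ^ 2 * ((L : ℝ) ^ (j + 1)) ^ 2 = ε ^ 2 := by
    rw [hxε]; field_simp
  have hregTA : 2 * (16 * Fintype.card n * (Fintype.card (T4AveragingDeficitWall.Plane d)) * x ^ 2 * ((L : ℝ) ^ (j + 1)) ^ 2) * (Fintype.card n : ℝ)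
        * (2 + 2 * A) * CPLine d L (Fintype.card n) εc θ * ((L : ℝ) ^ (j + 1)) ^ 2 ≤ 1 / 2 := by
    have e : 2 * (16 * Fintype.card n * (Fintype.card (T4AveragingDeficitWall.Plane d)) * x ^ 2 * ((L : ℝ) ^ (j + 1)) ^ 2) * (Fintype.card n : ℝ)
        * (2 + 2 * A) * CPLine d L (Fintype.card n) εc θ * ((L : ℝ) ^ (j + 1)) ^ 2
        = 32 * (Fintype.card n : ℝ) ^ 2 * (Fintype.card (T4AveragingDeficitWall.Plane d)) * (x ^ 2 * ((L : ℝ) ^ (j + 1)) ^ 2 * ((L : ℝ) ^ (j + 1)) ^ 2)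
          * ((2 + 2 * A) * CPLine d L (Fintype.card n) εc θ) := by ring
    rw [e, hx2]
    have hmono : (2 + 2 * A) * CPLine d L (Fintype.card n) εc θ ≤ (2 + 2 * A₅) * CPLine d L (Fintype.card n) εc θ :=
      mul_le_mul_of_nonneg_right (by linarith) hCP
    have hK0 : 0 ≤ 32 * (Fintype.card n : ℝ) ^ 2 * (Fintype.card (T4AveragingDeficitWall.Plane d)) * ε ^ 2 := by positivity
    calc 32 * (Fintype.card n : ℝ) ^ 2 * (Fintype.card (T4AveragingDeficitWall.Plane d)) * ε ^ 2 * ((2 + 2 * A) * CPLine d L (Fintype.card n) εc θ)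
        ≤ 32 * (Fintype.card n : ℝ) ^ 2 * (Fintype.card (T4AveragingDeficitWall.Plane d)) * ε ^ 2 * ((2 + 2 * A₅) * CPLine d L (Fintype.card n) εc θ) :=
          mul_le_mul_of_nonneg_left hmono hK0
      _ ≤ 1 / 2 := by rw [hA₅]; linarith [h5]
  -- F223
  have h := slicePoincare_TA_of_frameFree (N := N) (one_le_two.trans hL) hL hLd j hWu hWP hx hs hWx hWx hsmallG hCP hP hregTA t htQ htR
  refine h.trans (mul_le_mul_of_nonneg_right ?_ (NE3EnergyHessContTwoTerm.curlSq_nonneg _ _ _))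
  -- the constant: `4n·A·CP·M² ≤ 4n·A₅·CP·M²`
  have : 4 * (Fintype.card n : ℝ) * A * CPLine d L (Fintype.card n) εc θ * ((L : ℝ) ^ (j + 1)) ^ 2
      ≤ 4 * (Fintype.card n : ℝ) * A₅ * CPLine d L (Fintype.card n) εc θ * ((L : ℝ) ^ (j + 1)) ^ 2 := by
    gcongr
  rw [hA, hA₅] at this
  exact this

end

end Summit.QuantumFields.BalabanUV.T4Continuum.NE7SlicePoincareTAClass
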